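import Literature.MathematicalPhysics.KineticTheory.ConfinedFlowBounds
import Literature.MathematicalPhysics.KineticTheory.ConfinedDriftKernel
import Literature.MathematicalPhysics.KineticTheory.LangevinChainGeneratorStep
import Literature.Probability.Process.BrownianSupTail
import Literature.Analysis.Calculus.TaylorSegment
import HarnessLib

/-!
# The one-step generator estimate for an SDE with a regular confined drift and additive noise

Trunk T-KINETIC (Literature/MathematicalPhysics/KineticTheory). Model-free version of
`LangevinChainGeneratorStep.lean`, stated for the pathwise solution map `sdeSolMap Y v₁ v₂`
(`ConfinedDriftKernel.lean`) of the SDE `dz = Y(z) dt + v₁ dB¹ + v₂ dB²` on a finite-dimensional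
space `E`, whose drift carries a `RegularConfinedDrift` structure (`ConfinedFlowBounds.lean`) and
whose noise directions `v₁, v₂` lie in the noise subspace. It is the analytic heart of the Dynkin
identity `P_t f - f = ∫₀ᵗ P_s(Lf) ds` for the transition kernels `sdeKernel Y v₁ v₂`, used for the
heat-conduction chain of Rey-Bellet–Thomas (2002) (`ReyBelletThomas2002Kernel.lean`):

* `sdeGenerator Y v₁ v₂ f = Df·Y + ½ (D²f[v₁,v₁] + D²f[v₂,v₂])` — the generator on `C²` functions;
* the noise at a fixed time is the Gaussian vector `N_h = B¹_h v₁ + B²_h v₂`; its Gaussian integrals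
  `E ℓ(N_h) = 0`, `E Q(N_h,N_h) = h (Q(v₁,v₁) + Q(v₂,v₂))`, `E‖N_h‖² ≤ K₂ h`, `E‖N_h‖⁴ ≤ K₄ h²`;
* `RegularConfinedDrift.generator_step` — for every `f ∈ C²_c` and `ε > 0` there is `h₀ > 0` with
  `sup_y |E f(Φ_h(y, B)) - f(y) - h Lf(y)| ≤ ε h` for `0 < h ≤ h₀`: on the good event
  `{sup_{[0,h]}|B^b| ≤ a}` (`goodEvent`, complement of probability `O(h²)`) and below the far level the
  increment is `N_h + D` with `‖D‖ ≤ hY₁`, `‖D - hY(y)‖ ≤ L₁h(a + h)` (`flow_local_bounds`), so the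
  uniform second-order Taylor expansion (`taylor_two_uniform`) leaves `o(h)`; above the far level the
  flow does not meet the support (`flow_far`); off the good event the crude bound and AM–GM.
  The bookkeeping lemmas `taylor_bookkeeping`, `crude_bookkeeping`, `mul_le_amgm`, `le_amgm_sq`,
  `sq_le_pow_four_half` and the scalar Brownian integrability lemmas are reused from
  `LangevinChainGeneratorStep.lean`.

## References

* L. Rey-Bellet, L. E. Thomas, *Exponential convergence to non-equilibrium stationary states in
  classical statistical mechanics*, Comm. Math. Phys. 225 (2002) 305–329, §2 eq. (7), (13)
  (the SDE and its generator). [cite: ReyBelletThomas2002, §2]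
* D. Revuz, M. Yor, *Continuous Martingales and Brownian Motion* (1999), Ch. VII §1 (generator of a
  diffusion from the one-step expansion). [folklore]
-/

noncomputable section

open MeasureTheory ProbabilityTheory Filter Topology Set Metric
open scoped NNReal ENNReal

namespace Literature.MathematicalPhysics.KineticTheory

open Literature.Probability.Process Literature.Analysis.Calculus
open Literature.MathematicalPhysics.KineticTheory.HeatConduction (taylor_bookkeeping crude_bookkeeping
  mul_le_amgm le_amgm_sq sq_le_pow_four_half integrable_brownian_fst_mul_const
  integrable_brownian_snd_mul_const integrable_brownian_fst_mul_snd_mul_const)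

variable {E : Type*} [NormedAddCommGroup E] [NormedSpace ℝ E]

/-! ### The generator -/

/-- The **generator** of the SDE `dz = Y(z) dt + v₁ dB¹ + v₂ dB²` on `C²` functions:
`L f(y) = Df(y)·Y(y) + ½ (D²f(y)[v₁, v₁] + D²f(y)[v₂, v₂])`. [cite: ReyBelletThomas2002, §2 eq. (13)] -/
def sdeGenerator (Y : E → E) (v₁ v₂ : E) (f : E → ℝ) (y : E) : ℝ :=
  fderiv ℝ f y (Y y) + (1 / 2) * (fderiv ℝ (fderiv ℝ f) y v₁ v₁ + fderiv ℝ (fderiv ℝ f) y v₂ v₂)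

/-- Unfolding lemma for `sdeGenerator`. [folklore] -/
theorem sdeGenerator_def (Y : E → E) (v₁ v₂ : E) (f : E → ℝ) (y : E) :
    sdeGenerator Y v₁ v₂ f y =
      fderiv ℝ f y (Y y) + (1 / 2) * (fderiv ℝ (fderiv ℝ f) y v₁ v₁ + fderiv ℝ (fderiv ℝ f) y v₂ v₂) := rfl

/-! ### The noise vector at a fixed time -/

section Noise

variable (v₁ v₂ : E) (h : ℝ≥0)

/-- `‖B¹ v₁ + B² v₂‖ ≤ |B¹| ‖v₁‖ + |B²| ‖v₂‖`. [folklore] -/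
theorem norm_noiseVec_le (ω : WienerPair) :
    ‖brownian h ω.1 • v₁ + brownian h ω.2 • v₂‖ ≤ |brownian h ω.1| * ‖v₁‖ + |brownian h ω.2| * ‖v₂‖ := by
  refine (norm_add_le _ _).trans (add_le_add ?_ ?_) <;> rw [norm_smul, Real.norm_eq_abs]

/-- `‖N_h‖² ≤ 2(‖v₁‖² B¹² + ‖v₂‖² B²²)`. [folklore] -/
theorem norm_noiseVec_sq_le (ω : WienerPair) :
    ‖brownian h ω.1 • v₁ + brownian h ω.2 • v₂‖ ^ 2 ≤
      2 * (‖v₁‖ ^ 2 * brownian h ω.1 ^ 2 + ‖v₂‖ ^ 2 * brownian h ω.2 ^ 2) := by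
  have h1 := norm_noiseVec_le v₁ v₂ h ω
  have h0 : 0 ≤ ‖brownian h ω.1 • v₁ + brownian h ω.2 • v₂‖ := norm_nonneg _
  nlinarith [sq_nonneg (|brownian h ω.1| * ‖v₁‖ - |brownian h ω.2| * ‖v₂‖), sq_abs (brownian h ω.1),
    sq_abs (brownian h ω.2), norm_nonneg v₁, norm_nonneg v₂]

/-- `‖N_h‖⁴ ≤ 8(‖v₁‖⁴ B¹⁴ + ‖v₂‖⁴ B²⁴)`. [folklore] -/
theorem norm_noiseVec_pow_four_le (ω : WienerPair) :
    ‖brownian h ω.1 • v₁ + brownian h ω.2 • v₂‖ ^ 4 ≤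
      8 * (‖v₁‖ ^ 4 * brownian h ω.1 ^ 4 + ‖v₂‖ ^ 4 * brownian h ω.2 ^ 4) := by
  set a := |brownian h ω.1| * ‖v₁‖
  set b := |brownian h ω.2| * ‖v₂‖
  have h1 : ‖brownian h ω.1 • v₁ + brownian h ω.2 • v₂‖ ≤ a + b := norm_noiseVec_le v₁ v₂ h ω
  have h0 : 0 ≤ ‖brownian h ω.1 • v₁ + brownian h ω.2 • v₂‖ := norm_nonneg _
  have ha : 0 ≤ a := by positivity
  have hb : 0 ≤ b := by positivity
  have h2 : ‖brownian h ω.1 • v₁ + brownian h ω.2 • v₂‖ ^ 4 ≤ (a + b) ^ 4 := by gcongr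
  have h3 : (a + b) ^ 4 ≤ 8 * (a ^ 4 + b ^ 4) := by
    nlinarith [sq_nonneg (a - b), sq_nonneg (a + b), sq_nonneg (a ^ 2 - b ^ 2), mul_nonneg ha hb]
  have h4 : a ^ 4 = ‖v₁‖ ^ 4 * brownian h ω.1 ^ 4 := by
    have e : a ^ 4 = (|brownian h ω.1| ^ 2) ^ 2 * (‖v₁‖ ^ 2) ^ 2 := by ring
    rw [e, sq_abs]; ring
  have h5 : b ^ 4 = ‖v₂‖ ^ 4 * brownian h ω.2 ^ 4 := by
    have e : b ^ 4 = (|brownian h ω.2| ^ 2) ^ 2 * (‖v₂‖ ^ 2) ^ 2 := by ring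
    rw [e, sq_abs]; ring
  linarith

/-- A continuous linear functional of the noise vector is integrable. [folklore] -/
theorem integrable_clm_noiseVec (ℓ : E →L[ℝ] ℝ) :
    Integrable (fun ω : WienerPair => ℓ (brownian h ω.1 • v₁ + brownian h ω.2 • v₂)) wienerPair := by
  have h12 : Integrable (fun ω : WienerPair => brownian h ω.1 * ℓ v₁ + brownian h ω.2 * ℓ v₂) wienerPair :=
    (integrable_brownian_fst_mul_const h _).add (integrable_brownian_snd_mul_const h _)
  refine h12.congr (Eventually.of_forall fun ω => ?_)
  simp only [map_add, map_smul, smul_eq_mul]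

/-- A continuous linear functional of the noise vector integrates to zero. [folklore] -/
theorem integral_clm_noiseVec (ℓ : E →L[ℝ] ℝ) :
    ∫ ω, ℓ (brownian h ω.1 • v₁ + brownian h ω.2 • v₂) ∂wienerPair = 0 := by
  have hexp : (fun ω : WienerPair => ℓ (brownian h ω.1 • v₁ + brownian h ω.2 • v₂)) =
      fun ω => brownian h ω.1 * ℓ v₁ + brownian h ω.2 * ℓ v₂ := by
    funext ω; simp only [map_add, map_smul, smul_eq_mul]
  rw [hexp, integral_add (integrable_brownian_fst_mul_const h _) (integrable_brownian_snd_mul_const h _),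
    integral_mul_const, integral_mul_const, integral_brownian_fst, integral_brownian_snd]
  simp

/-- **The second-order Gaussian identity**: for a continuous bilinear form `Q`,
`E[Q(N_h, N_h)] = h (Q(v₁, v₁) + Q(v₂, v₂))` (`E B² = h`, `E[B¹B²] = 0`). [folklore] -/
theorem integral_bilin_noiseVec (Q : E →L[ℝ] E →L[ℝ] ℝ) :
    ∫ ω, Q (brownian h ω.1 • v₁ + brownian h ω.2 • v₂) (brownian h ω.1 • v₁ + brownian h ω.2 • v₂) ∂wienerPair =
      h * (Q v₁ v₁ + Q v₂ v₂) := by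
  have hexp : (fun ω : WienerPair => Q (brownian h ω.1 • v₁ + brownian h ω.2 • v₂)
      (brownian h ω.1 • v₁ + brownian h ω.2 • v₂)) = fun ω =>
      brownian h ω.1 ^ 2 * Q v₁ v₁ + brownian h ω.1 * brownian h ω.2 * (Q v₁ v₂ + Q v₂ v₁) +
        brownian h ω.2 ^ 2 * Q v₂ v₂ := by
    funext ω
    simp only [map_add, map_smul, add_apply, FunLike.coe_smul, Pi.smul_apply, smul_eq_mul]
    ring
  rw [hexp]
  have h1 : Integrable (fun ω : WienerPair => brownian h ω.1 ^ 2 * Q v₁ v₁) wienerPair :=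
    (integrable_brownian_fst_pow h 2).mul_const _
  have h2 : Integrable (fun ω : WienerPair => brownian h ω.1 * brownian h ω.2 * (Q v₁ v₂ + Q v₂ v₁)) wienerPair :=
    integrable_brownian_fst_mul_snd_mul_const h _
  have h3 : Integrable (fun ω : WienerPair => brownian h ω.2 ^ 2 * Q v₂ v₂) wienerPair :=
    (integrable_brownian_snd_pow h 2).mul_const _
  have h12 : Integrable (fun ω : WienerPair => brownian h ω.1 ^ 2 * Q v₁ v₁ +
      brownian h ω.1 * brownian h ω.2 * (Q v₁ v₂ + Q v₂ v₁)) wienerPair := h1.add h2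
  rw [integral_add h12 h3, integral_add h1 h2, integral_mul_const, integral_mul_const,
    integral_mul_const, integral_brownian_fst_sq, integral_brownian_snd_sq,
    integral_brownian_fst_mul_brownian_snd]
  ring

omit [NormedSpace ℝ E] in
/-- `E‖N_h‖² ≤ 2(‖v₁‖² + ‖v₂‖²) h`: integral form for a dominated nonnegative functional. [folklore] -/
theorem integral_norm_noiseVec_sq_le' {F : WienerPair → ℝ}
    (hF : ∀ ω, F ω ≤ 2 * (‖v₁‖ ^ 2 * brownian h ω.1 ^ 2 + ‖v₂‖ ^ 2 * brownian h ω.2 ^ 2))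
    (hF0 : ∀ ω, 0 ≤ F ω) :
    ∫ ω, F ω ∂wienerPair ≤ 2 * (‖v₁‖ ^ 2 + ‖v₂‖ ^ 2) * h := by
  have hA : Integrable (fun ω : WienerPair => ‖v₁‖ ^ 2 * brownian h ω.1 ^ 2) wienerPair :=
    (integrable_brownian_fst_pow h 2).const_mul _
  have hB : Integrable (fun ω : WienerPair => ‖v₂‖ ^ 2 * brownian h ω.2 ^ 2) wienerPair :=
    (integrable_brownian_snd_pow h 2).const_mul _
  have hint : Integrable (fun ω : WienerPair => 2 * (‖v₁‖ ^ 2 * brownian h ω.1 ^ 2 + ‖v₂‖ ^ 2 * brownian h ω.2 ^ 2))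
      wienerPair := (hA.add hB).const_mul _
  calc ∫ ω, F ω ∂wienerPair
      ≤ ∫ ω : WienerPair, 2 * (‖v₁‖ ^ 2 * brownian h ω.1 ^ 2 + ‖v₂‖ ^ 2 * brownian h ω.2 ^ 2) ∂wienerPair :=
        integral_mono_of_nonneg (Eventually.of_forall hF0) hint (Eventually.of_forall hF)
    _ = 2 * (‖v₁‖ ^ 2 + ‖v₂‖ ^ 2) * h := by
        rw [integral_const_mul, integral_add hA hB, integral_const_mul, integral_const_mul,
          integral_brownian_fst_sq, integral_brownian_snd_sq]
        ring

omit [NormedSpace ℝ E] in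
/-- `E‖N_h‖⁴ ≤ 24(‖v₁‖⁴ + ‖v₂‖⁴) h²`: integral form for a dominated nonnegative functional. [folklore] -/
theorem integral_norm_noiseVec_pow_four_le' {F : WienerPair → ℝ}
    (hF : ∀ ω, F ω ≤ 8 * (‖v₁‖ ^ 4 * brownian h ω.1 ^ 4 + ‖v₂‖ ^ 4 * brownian h ω.2 ^ 4))
    (hF0 : ∀ ω, 0 ≤ F ω) :
    ∫ ω, F ω ∂wienerPair ≤ 24 * (‖v₁‖ ^ 4 + ‖v₂‖ ^ 4) * (h : ℝ) ^ 2 := by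
  have hA : Integrable (fun ω : WienerPair => ‖v₁‖ ^ 4 * brownian h ω.1 ^ 4) wienerPair :=
    (integrable_brownian_fst_pow h 4).const_mul _
  have hB : Integrable (fun ω : WienerPair => ‖v₂‖ ^ 4 * brownian h ω.2 ^ 4) wienerPair :=
    (integrable_brownian_snd_pow h 4).const_mul _
  have hint : Integrable (fun ω : WienerPair => 8 * (‖v₁‖ ^ 4 * brownian h ω.1 ^ 4 + ‖v₂‖ ^ 4 * brownian h ω.2 ^ 4))
      wienerPair := (hA.add hB).const_mul _
  calc ∫ ω, F ω ∂wienerPair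
      ≤ ∫ ω : WienerPair, 8 * (‖v₁‖ ^ 4 * brownian h ω.1 ^ 4 + ‖v₂‖ ^ 4 * brownian h ω.2 ^ 4) ∂wienerPair :=
        integral_mono_of_nonneg (Eventually.of_forall hF0) hint (Eventually.of_forall hF)
    _ = 24 * (‖v₁‖ ^ 4 + ‖v₂‖ ^ 4) * (h : ℝ) ^ 2 := by
        rw [integral_const_mul, integral_add hA hB, integral_const_mul, integral_const_mul,
          integral_brownian_fst_pow_four, integral_brownian_snd_pow_four]
        ring

/-- `E‖N_h‖² ≤ 2(‖v₁‖² + ‖v₂‖²) h`. [folklore] -/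
theorem integral_norm_noiseVec_sq_le :
    ∫ ω, ‖brownian h ω.1 • v₁ + brownian h ω.2 • v₂‖ ^ 2 ∂wienerPair ≤ 2 * (‖v₁‖ ^ 2 + ‖v₂‖ ^ 2) * h :=
  integral_norm_noiseVec_sq_le' v₁ v₂ h (norm_noiseVec_sq_le v₁ v₂ h) fun ω => by positivity

/-- `E‖N_h‖⁴ ≤ 24(‖v₁‖⁴ + ‖v₂‖⁴) h²`. [folklore] -/
theorem integral_norm_noiseVec_pow_four_le :
    ∫ ω, ‖brownian h ω.1 • v₁ + brownian h ω.2 • v₂‖ ^ 4 ∂wienerPair ≤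
      24 * (‖v₁‖ ^ 4 + ‖v₂‖ ^ 4) * (h : ℝ) ^ 2 :=
  integral_norm_noiseVec_pow_four_le' v₁ v₂ h (norm_noiseVec_pow_four_le v₁ v₂ h) fun ω => by positivity

variable [MeasurableSpace E] [BorelSpace E] [SecondCountableTopology E]

/-- The noise vector is a measurable function of the pair. [folklore] -/
@[fun_prop]
theorem measurable_noiseVec :
    Measurable fun ω : WienerPair => brownian h ω.1 • v₁ + brownian h ω.2 • v₂ :=
  (((measurable_brownian h).comp measurable_fst).smul_const _).add
    (((measurable_brownian h).comp measurable_snd).smul_const _)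

/-- `‖N_h‖²` is integrable. [folklore] -/
theorem integrable_norm_noiseVec_sq :
    Integrable (fun ω : WienerPair => ‖brownian h ω.1 • v₁ + brownian h ω.2 • v₂‖ ^ 2) wienerPair := by
  have hint : Integrable (fun ω : WienerPair => 2 * (‖v₁‖ ^ 2 * brownian h ω.1 ^ 2 + ‖v₂‖ ^ 2 * brownian h ω.2 ^ 2))
      wienerPair :=
    (((integrable_brownian_fst_pow h 2).const_mul _).add ((integrable_brownian_snd_pow h 2).const_mul _)).const_mul _
  refine hint.mono' ((measurable_noiseVec v₁ v₂ h).norm.pow_const 2).aestronglyMeasurable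
    (Eventually.of_forall fun ω => ?_)
  rw [Real.norm_eq_abs, abs_pow, abs_norm]
  exact norm_noiseVec_sq_le v₁ v₂ h ω

/-- `‖N_h‖⁴` is integrable. [folklore] -/
theorem integrable_norm_noiseVec_pow_four :
    Integrable (fun ω : WienerPair => ‖brownian h ω.1 • v₁ + brownian h ω.2 • v₂‖ ^ 4) wienerPair := by
  have hint : Integrable (fun ω : WienerPair => 8 * (‖v₁‖ ^ 4 * brownian h ω.1 ^ 4 + ‖v₂‖ ^ 4 * brownian h ω.2 ^ 4))
      wienerPair :=
    (((integrable_brownian_fst_pow h 4).const_mul _).add ((integrable_brownian_snd_pow h 4).const_mul _)).const_mul _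
  refine hint.mono' ((measurable_noiseVec v₁ v₂ h).norm.pow_const 4).aestronglyMeasurable
    (Eventually.of_forall fun ω => ?_)
  rw [Real.norm_eq_abs, abs_pow, abs_norm]
  exact norm_noiseVec_pow_four_le v₁ v₂ h ω

/-- A continuous bilinear form of the noise vector is integrable. [folklore] -/
theorem integrable_bilin_noiseVec (Q : E →L[ℝ] E →L[ℝ] ℝ) :
    Integrable (fun ω : WienerPair =>
      Q (brownian h ω.1 • v₁ + brownian h ω.2 • v₂) (brownian h ω.1 • v₁ + brownian h ω.2 • v₂)) wienerPair := by
  have hint : Integrable (fun ω : WienerPair => ‖Q‖ * ‖brownian h ω.1 • v₁ + brownian h ω.2 • v₂‖ ^ 2) wienerPair :=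
    (integrable_norm_noiseVec_sq v₁ v₂ h).const_mul ‖Q‖
  have hm := measurable_noiseVec v₁ v₂ h
  refine hint.mono' (Q.continuous₂.measurable.comp (hm.prodMk hm)).aestronglyMeasurable
    (Eventually.of_forall fun ω => ?_)
  rw [Real.norm_eq_abs]
  set v := brownian h ω.1 • v₁ + brownian h ω.2 • v₂
  calc |Q v v| = ‖Q v v‖ := (Real.norm_eq_abs _).symm
    _ ≤ ‖Q v‖ * ‖v‖ := ContinuousLinearMap.le_opNorm _ _
    _ ≤ ‖Q‖ * ‖v‖ * ‖v‖ := mul_le_mul_of_nonneg_right (ContinuousLinearMap.le_opNorm _ _) (norm_nonneg _)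
    _ = ‖Q‖ * ‖v‖ ^ 2 := by ring

omit [MeasurableSpace E] [BorelSpace E] [SecondCountableTopology E] in
/-- The noise path of the Brownian pair at the (nonnegative) time `h` is the noise vector.
[folklore] -/
theorem pairNoise_pairPath_coe (ω : WienerPair) :
    pairNoise v₁ v₂ (pairPath ω) (h : ℝ) = brownian h ω.1 • v₁ + brownian h ω.2 • v₂ := by
  rw [pairNoise_pairPath, Real.toNNReal_coe]

omit [MeasurableSpace E] [BorelSpace E] [SecondCountableTopology E] in
/-- `‖n(t)‖ ≤ |B¹_{t⁺}| ‖v₁‖ + |B²_{t⁺}| ‖v₂‖` for the noise path of the Brownian pair. [folklore] -/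
theorem norm_pairNoise_pairPath_le (ω : WienerPair) (t : ℝ) :
    ‖pairNoise v₁ v₂ (pairPath ω) t‖ ≤
      |brownian t.toNNReal ω.1| * ‖v₁‖ + |brownian t.toNNReal ω.2| * ‖v₂‖ := by
  rw [pairNoise_pairPath]
  exact norm_noiseVec_le v₁ v₂ _ ω

end Noise

/-! ### The one-step estimate -/

namespace RegularConfinedDrift

variable [FiniteDimensional ℝ E] [CompleteSpace E] [MeasurableSpace E] [BorelSpace E]
  [SecondCountableTopology E] {Y : E → E} (D : RegularConfinedDrift Y) {v₁ v₂ : E}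
  (hv₁ : v₁ ∈ D.noise) (hv₂ : v₂ ∈ D.noise)
include D hv₁ hv₂

set_option maxHeartbeats 1600000 in
-- one long bookkeeping proof (constants, pointwise bound, integration, budget): ~8× the default budget
/-- **The one-step generator estimate, uniform in the starting point.** For a regular confined
drift `Y`, noise directions `v₁, v₂` in the noise subspace, every `f ∈ C²_c` and every `ε > 0`
there is `h₀ > 0` such that for all `0 < h ≤ h₀` and ALL `y`,
`|E f(Φ_h(y, B)) - f(y) - h·Lf(y)| ≤ ε h`, `L = sdeGenerator Y v₁ v₂`.
Proof: on the good event `{sup_{[0,h]}|B^b| ≤ a}` the flow increment is `Δ = N_h + D` with the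
Gaussian noise vector `N_h = B¹_h v₁ + B²_h v₂` and a drift part `D = hY(y) + O(h(a + h))`
(`flow_local_bounds`), so the second-order Taylor expansion (`taylor_two_uniform`) and
`E[Df·N_h] = 0`, `½E[D²f(N_h,N_h)] = h/2 (D²f[v₁,v₁] + D²f[v₂,v₂])` (`integral_bilin_noiseVec`) leave
`o(h)`; far from the support the flow does not reach it (`flow_far`); the bad event has
probability `O(h²)` (`measure_compl_goodEvent_le`). The generator is that of
[cite: ReyBelletThomas2002, §2 eq. (13)]; the estimate itself is standard. [folklore] -/
theorem generator_step {f : E → ℝ} (hf : ContDiff ℝ 2 f) (hfc : HasCompactSupport f) {ε : ℝ} (hε : 0 < ε) :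
    ∃ h₀ : ℝ, 0 < h₀ ∧ ∀ h : ℝ≥0, 0 < (h : ℝ) → (h : ℝ) ≤ h₀ → ∀ y : E,
      |(∫ ω, f (sdeSolMap Y v₁ v₂ h y (pairPath ω)) ∂wienerPair) - f y -
          h * sdeGenerator Y v₁ v₂ f y| ≤ ε * h := by
  -- constants of the test function
  have hf1 : ContDiff ℝ 1 f := hf.of_le (by norm_num)
  obtain ⟨M₀, hM₀0, hM₀⟩ := exists_forall_norm_le_of_hasCompactSupport hf.continuous hfc
  obtain ⟨M₁, hM₁0, hM₁⟩ := exists_forall_norm_fderiv_le hf1 hfc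
  obtain ⟨M₂, hM₂0, hM₂⟩ := exists_forall_norm_fderiv_fderiv_le hf hfc
  -- the support sits below an energy level `E_K`
  obtain ⟨E_K, hE_K⟩ : ∃ E_K : ℝ, ∀ x ∈ tsupport f, D.V x ≤ E_K := by
    obtain ⟨C, hC⟩ := hfc.isCompact.exists_bound_of_continuousOn D.continuous_energy.continuousOn
    exact ⟨C, fun x hx => (le_abs_self _).trans ((Real.norm_eq_abs _).symm.le.trans (hC x hx))⟩
  -- far level `E₁` and local constants below it
  obtain ⟨E₁, hE₁0, hfar⟩ := D.flow_far E_K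
  obtain ⟨R₀, Y₁, L₁, -, hY₁, hL₁, hloc⟩ := D.flow_local_bounds hE₁0
  -- above `E₁` the test function and its derivatives vanish
  have hfar0 : ∀ x : E, E₁ < D.V x → x ∉ tsupport f := by
    intro x hx hmem
    have h1 := hfar x hx (n := fun _ => (0 : E)) continuous_const (fun _ => D.noise.zero_mem) (T := 0) (M := 0)
      (fun t _ => by simp) (by norm_num) (by rw [mul_zero]; norm_num) zero_le_one 0 ⟨le_rfl, le_rfl⟩
    rw [D.flow_of_nonpos x continuous_const le_rfl, add_zero] at h1
    exact absurd (hE_K x hmem) (not_le.2 h1)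
  have hfar_f : ∀ x : E, E₁ < D.V x → f x = 0 := fun x hx =>
    image_eq_zero_of_notMem_tsupport (hfar0 x hx)
  have hfar_Df : ∀ x : E, E₁ < D.V x → fderiv ℝ f x = 0 := fun x hx =>
    Function.notMem_support.1 fun hmem => hfar0 x hx (support_fderiv_subset ℝ hmem)
  have hfar_Q : ∀ x : E, E₁ < D.V x → fderiv ℝ (fderiv ℝ f) x = 0 := fun x hx =>
    Function.notMem_support.1 fun hmem => hfar0 x hx (tsupport_fderiv_subset ℝ (support_fderiv_subset ℝ hmem))
  -- a bound `Yb` of the drift on `{V ≤ E₁}` (for the crude bound off the good event)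
  obtain ⟨Yb, hYb0, hYb⟩ : ∃ Yb : ℝ, 0 ≤ Yb ∧ ∀ x : E, D.V x ≤ E₁ → ‖Y x‖ ≤ Yb := by
    obtain ⟨C, hC⟩ := (isCompact_closedBall (0 : E) (D.ρ E₁)).exists_bound_of_continuousOn
      D.contDiff_drift.continuous.continuousOn
    refine ⟨max C 0, le_max_right _ _, fun x hx => (hC x ?_).trans (le_max_left _ _)⟩
    exact mem_closedBall_zero_iff.2 (D.norm_le_radius x E₁ hx)
  -- Gaussian constants
  obtain ⟨K₂, hK₂⟩ : ∃ K₂ : ℝ, K₂ = 2 * (‖v₁‖ ^ 2 + ‖v₂‖ ^ 2) := ⟨_, rfl⟩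
  obtain ⟨K₄, hK₄⟩ : ∃ K₄ : ℝ, K₄ = 24 * (‖v₁‖ ^ 4 + ‖v₂‖ ^ 4) := ⟨_, rfl⟩
  have hK₂0 : 0 ≤ K₂ := by rw [hK₂]; positivity
  have hK₄0 : 0 ≤ K₄ := by rw [hK₄]; positivity
  obtain ⟨c, hc⟩ : ∃ c : ℝ, c = ‖v₁‖ + ‖v₂‖ + 1 := ⟨_, rfl⟩
  have hc1 : ‖v₁‖ + ‖v₂‖ ≤ c := by rw [hc]; linarith
  have hc0 : 0 < c := by rw [hc]; have := norm_nonneg v₁; have := norm_nonneg v₂; linarith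
  have hKs := D.Kshift_nonneg
  -- small parameters
  obtain ⟨ε', hε'⟩ : ∃ ε' : ℝ, ε' = ε / (10 * (2 * K₂ + 1)) := ⟨_, rfl⟩
  have hε'0 : 0 < ε' := by rw [hε']; positivity
  obtain ⟨ρ, hρ, htaylor⟩ := taylor_two_uniform hf hfc hε'0
  obtain ⟨lam', hlam'⟩ : ∃ lam' : ℝ, lam' = ε / (10 * (M₂ * Y₁ + 1)) := ⟨_, rfl⟩
  have hlam'0 : 0 < lam' := by rw [hlam']; positivity
  obtain ⟨lam₁, hlam₁⟩ : ∃ lam₁ : ℝ, lam₁ = ε / (10 * (M₁ * K₂ + 1)) := ⟨_, rfl⟩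
  have hlam₁0 : 0 < lam₁ := by rw [hlam₁]; positivity
  obtain ⟨a, ha⟩ : ∃ a : ℝ, a = min (min (1 / (2 * c)) (ρ / (2 * c)))
    (min (ε / (10 * c * (M₁ * L₁ + 1))) (1 / (2 * c * (D.Kshift + 1)))) := ⟨_, rfl⟩
  have ha0 : 0 < a := by rw [ha]; positivity
  have hac2 : c * a ≤ 1 / 2 := by
    have : a ≤ 1 / (2 * c) := by rw [ha]; exact (min_le_left _ _).trans (min_le_left _ _)
    rw [le_div_iff₀ (by positivity)] at this; linarith
  have hacρ : c * a ≤ ρ / 2 := by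
    have : a ≤ ρ / (2 * c) := by rw [ha]; exact (min_le_left _ _).trans (min_le_right _ _)
    rw [le_div_iff₀ (by positivity)] at this; linarith
  have hacε : M₁ * L₁ * (c * a) ≤ ε / 10 := by
    have h1 : a ≤ ε / (10 * c * (M₁ * L₁ + 1)) := by rw [ha]; exact (min_le_right _ _).trans (min_le_left _ _)
    rw [le_div_iff₀ (by positivity)] at h1
    have h2 : M₁ * L₁ * (c * a) ≤ (M₁ * L₁ + 1) * (c * a) :=
      mul_le_mul_of_nonneg_right (by linarith) (by positivity)
    have h3 : (M₁ * L₁ + 1) * (c * a) = a * (10 * c * (M₁ * L₁ + 1)) / 10 := by ring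
    have h4 : (M₁ * L₁ + 1) * (c * a) ≤ ε / 10 := by rw [h3]; linarith
    exact h2.trans h4
  have hacK : D.Kshift * (c * a) ≤ 1 / 2 := by
    have h1 : a ≤ 1 / (2 * c * (D.Kshift + 1)) := by rw [ha]; exact (min_le_right _ _).trans (min_le_right _ _)
    rw [le_div_iff₀ (by positivity)] at h1
    have h2 : D.Kshift * (c * a) ≤ (D.Kshift + 1) * (c * a) :=
      mul_le_mul_of_nonneg_right (by linarith) (by positivity)
    nlinarith
  -- the `O(h²)` coefficient and `h₀`
  obtain ⟨γ₄, hγ₄⟩ : ∃ γ₄ : ℝ, γ₄ = M₂ / 4 := ⟨_, rfl⟩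
  have hγ₄0 : 0 ≤ γ₄ := by rw [hγ₄]; positivity
  obtain ⟨γc₀, hγc₀⟩ : ∃ γc₀ : ℝ, γc₀ = 2 * M₀ + M₁ * Yb + M₁ / (2 * lam₁) + M₂ / 4 := ⟨_, rfl⟩
  have hγc₀0 : 0 ≤ γc₀ := by rw [hγc₀]; positivity
  obtain ⟨Dc, hD⟩ : ∃ Dc : ℝ, Dc = M₁ * L₁ * Y₁ + M₂ * Y₁ ^ 2 / 2 + 2 * ε' * Y₁ ^ 2 + M₂ * Y₁ * K₂ / (2 * lam') +
    γ₄ * K₄ + γc₀ * (16 / a ^ 4) := ⟨_, rfl⟩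
  have hD0 : 0 ≤ Dc := by rw [hD]; positivity
  obtain ⟨h₀, hh₀⟩ : ∃ h₀ : ℝ, h₀ = min (min 1 (a ^ 2 / 2)) (min (ρ / (2 * (Y₁ + 1))) (ε / (2 * (Dc + 1)))) := ⟨_, rfl⟩
  have hh₀0 : 0 < h₀ := by rw [hh₀]; positivity
  refine ⟨h₀, hh₀0, fun h hhpos hh y => ?_⟩
  -- consequences of `h ≤ h₀`
  have hh0 : 0 ≤ (h : ℝ) := h.coe_nonneg
  rw [hh₀] at hh
  have hh1 : (h : ℝ) ≤ 1 := hh.trans ((min_le_left _ _).trans (min_le_left _ _))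
  have hha : (h : ℝ) ≤ a ^ 2 / 2 := hh.trans ((min_le_left _ _).trans (min_le_right _ _))
  have hhρ : (h : ℝ) * Y₁ ≤ ρ / 2 := by
    have h1 : (h : ℝ) ≤ ρ / (2 * (Y₁ + 1)) := hh.trans ((min_le_right _ _).trans (min_le_left _ _))
    rw [le_div_iff₀ (by positivity)] at h1
    have h2 : (h : ℝ) * (2 * (Y₁ + 1)) = 2 * (h * Y₁) + 2 * h := by ring
    linarith
  have hhD : (h : ℝ) * Dc ≤ ε / 2 := by
    have h1 : (h : ℝ) ≤ ε / (2 * (Dc + 1)) := hh.trans ((min_le_right _ _).trans (min_le_right _ _))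
    rw [le_div_iff₀ (by positivity)] at h1
    have h2 : (h : ℝ) * (2 * (Dc + 1)) = 2 * (h * Dc) + 2 * h := by ring
    linarith
  -- the random variables
  set η : WienerPair → ℝ → E := fun ω => pairNoise v₁ v₂ (pairPath ω) with hη
  set Z : WienerPair → E := fun ω => sdeSolMap Y v₁ v₂ h y (pairPath ω) with hZ
  set Nv : WienerPair → E := fun ω => brownian h ω.1 • v₁ + brownian h ω.2 • v₂ with hNv
  set Df := fderiv ℝ f y with hDf
  set Q := fderiv ℝ (fderiv ℝ f) y with hQ
  set W : WienerPair → ℝ := fun ω =>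
    f (Z ω) - f y - Df (Nv ω) - (1 / 2) * Q (Nv ω) (Nv ω) - h * Df (Y y) with hW
  set G := goodEvent a h with hG
  set χ : WienerPair → ℝ := (Gᶜ).indicator 1 with hχ
  have hZ_def : ∀ ω, Z ω = drivenFlow Y y (η ω) h := fun ω => rfl
  have hNv_eq : ∀ ω, η ω h = Nv ω := fun ω => pairNoise_pairPath_coe v₁ v₂ h ω
  have hηc : ∀ ω, Continuous (η ω) := fun ω => continuous_pairNoise v₁ v₂ (pairPath ω)
  have hηS : ∀ ω t, η ω t ∈ D.noise := fun ω t => pairNoise_mem v₁ v₂ hv₁ hv₂ (pairPath ω) t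
  -- coefficients of the pointwise bound
  obtain ⟨γ₀, hγ₀⟩ : ∃ γ₀ : ℝ, γ₀ = M₁ * L₁ * h * (c * a + h * Y₁) + M₂ * h ^ 2 * Y₁ ^ 2 / 2 + 2 * ε' * h ^ 2 * Y₁ ^ 2 +
    M₂ * h * Y₁ * lam' / 2 := ⟨_, rfl⟩
  obtain ⟨γ₂, hγ₂⟩ : ∃ γ₂ : ℝ, γ₂ = 2 * ε' + M₂ * h * Y₁ / (2 * lam') + lam₁ / 2 * M₁ := ⟨_, rfl⟩
  obtain ⟨γc, hγc⟩ : ∃ γc : ℝ, γc = 2 * M₀ + h * M₁ * Yb + M₁ / (2 * lam₁) + M₂ / 4 := ⟨_, rfl⟩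
  have hγ₀0 : 0 ≤ γ₀ := by rw [hγ₀]; positivity
  have hγ₂0 : 0 ≤ γ₂ := by rw [hγ₂]; positivity
  have hγc0 : 0 ≤ γc := by rw [hγc]; positivity
  have hγcle : γc ≤ γc₀ := by
    rw [hγc, hγc₀]
    have h1 := mul_le_of_le_one_left (mul_nonneg hM₁0 hYb0) hh1
    have h2 : (h : ℝ) * M₁ * Yb = h * (M₁ * Yb) := by ring
    linarith
  ---------------------------------------------------------------------------------------------
  -- Step 1: the pointwise bound `|W| ≤ γ₀ + γ₂‖N‖² + γ₄‖N‖⁴ + γc χ`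
  ---------------------------------------------------------------------------------------------
  have hdrift : |(h : ℝ) * Df (Y y)| ≤ h * M₁ * Yb := by
    rw [abs_mul, abs_of_nonneg hh0, mul_assoc]
    refine mul_le_mul_of_nonneg_left ?_ hh0
    rcases le_or_gt (D.V y) E₁ with hy | hy
    · rw [← Real.norm_eq_abs]
      exact (ContinuousLinearMap.le_opNorm _ _).trans (mul_le_mul (hM₁ y) (hYb y hy) (norm_nonneg _) hM₁0)
    · rw [hDf, hfar_Df y hy]; simp; positivity
  have hpt : ∀ ω, |W ω| ≤ γ₀ + γ₂ * ‖Nv ω‖ ^ 2 + γ₄ * ‖Nv ω‖ ^ 4 + γc * χ ω := by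
    intro ω
    obtain ⟨nN, hnN⟩ : ∃ r : ℝ, r = ‖Nv ω‖ := ⟨_, rfl⟩
    have hNn : 0 ≤ nN := by rw [hnN]; exact norm_nonneg _
    rw [← hnN]
    by_cases hωG : ω ∈ G
    · -- on the good event
      have hχ0 : χ ω = 0 := by
        have : ω ∉ Gᶜ := fun h' => h' hωG
        simp [hχ, this]
      have hMη : ∀ t ∈ Icc (0 : ℝ) h, ‖η ω t‖ ≤ c * a := by
        intro t ht
        have hB := abs_brownian_toNNReal_le_of_mem_goodEvent hωG (s := t) ht.2
        refine (norm_pairNoise_pairPath_le v₁ v₂ ω t).trans ?_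
        calc |brownian t.toNNReal ω.1| * ‖v₁‖ + |brownian t.toNNReal ω.2| * ‖v₂‖
            ≤ a * ‖v₁‖ + a * ‖v₂‖ := add_le_add (mul_le_mul_of_nonneg_right hB.1 (norm_nonneg _))
              (mul_le_mul_of_nonneg_right hB.2 (norm_nonneg _))
          _ = (‖v₁‖ + ‖v₂‖) * a := by ring
          _ ≤ c * a := mul_le_mul_of_nonneg_right hc1 ha0.le
      have hNvn : nN ≤ c * a := by
        rw [hnN, ← hNv_eq]
        exact hMη h ⟨hh0, le_rfl⟩
      rcases le_or_gt (D.V y) E₁ with hy | hy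
      · -- near the support: Taylor
        obtain ⟨-, hD1, hD2⟩ := hloc y hy (hηc ω) (hηS ω) hMη (by linarith) hh1 h ⟨hh0, le_rfl⟩
        set Dv := Z ω - y - Nv ω with hDv
        have hZsplit : Z ω = y + (Nv ω + Dv) := by rw [hDv]; abel
        have hD1' : ‖Dv‖ ≤ h * Y₁ := by
          rw [hDv, ← hNv_eq]; exact hD1
        have hD2' : ‖Dv - (h : ℝ) • Y y‖ ≤ L₁ * h * (c * a + h * Y₁) := by
          rw [hDv, ← hNv_eq]; exact hD2
        have hΔρ : ‖Nv ω + Dv‖ ≤ ρ := by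
          refine (norm_add_le _ _).trans ?_
          rw [← hnN]
          linarith
        have hT := htaylor y (Nv ω + Dv) hΔρ
        have hbk := taylor_bookkeeping f y (Nv ω) Dv ((h : ℝ) • Y y) Df Q hε'0.le hM₂0 hT
          (hM₁ y) (hM₂ y) hD1' hD2'
        rw [← hnN] at hbk
        have hWeq : W ω = f (y + (Nv ω + Dv)) - f y - Df (Nv ω) - (1 / 2) * Q (Nv ω) (Nv ω) -
            Df ((h : ℝ) • Y y) := by
          rw [← hZsplit, map_smul, smul_eq_mul]
        rw [hWeq]
        refine hbk.trans ?_
        have ham := mul_le_amgm (a := M₂ * (h * Y₁)) (s := nN) (by positivity) hlam'0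
        rw [hχ0, mul_zero, add_zero, hγ₀, hγ₂]
        have e1 : M₂ * nN * (h * Y₁) = M₂ * (h * Y₁) * nN := by ring
        have e2 : M₂ * (↑h * Y₁) * lam' / 2 = M₂ * ↑h * Y₁ * lam' / 2 := by ring
        have e3 : M₂ * (↑h * Y₁) / (2 * lam') * nN ^ 2 = M₂ * ↑h * Y₁ / (2 * lam') * nN ^ 2 := by ring
        have e4 : ε' * (2 * nN ^ 2 + 2 * (↑h * Y₁) ^ 2) = 2 * ε' * nN ^ 2 + 2 * ε' * ↑h ^ 2 * Y₁ ^ 2 := by ring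
        have e5 : M₁ * (L₁ * ↑h * (c * a + ↑h * Y₁)) = M₁ * L₁ * ↑h * (c * a + ↑h * Y₁) := by ring
        have e6 : M₂ * (↑h * Y₁) ^ 2 / 2 = M₂ * ↑h ^ 2 * Y₁ ^ 2 / 2 := by ring
        have hsq4 : 0 ≤ γ₄ * nN ^ 4 := by positivity
        have hlam₁t : 0 ≤ lam₁ / 2 * M₁ * nN ^ 2 := by positivity
        rw [e1, e4, e5, e6]
        rw [e2, e3] at ham
        linarith
      · -- far from the support: `W ω = 0`
        have hZfar : E_K < D.V (Z ω) := by
          rw [hZ_def]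
          exact hfar y hy (hηc ω) (hηS ω) hMη (by linarith) hacK hh1 h ⟨hh0, le_rfl⟩
        have hfZ : f (Z ω) = 0 :=
          image_eq_zero_of_notMem_tsupport fun hmem => absurd (hE_K _ hmem) (not_le.2 hZfar)
        have hW0 : W ω = 0 := by
          simp only [hW, hfZ, hfar_f y hy, hDf, hfar_Df y hy, hQ, hfar_Q y hy]
          simp
        rw [hW0, abs_zero]
        positivity
    · -- off the good event: the crude bound
      have hχ1 : χ ω = 1 := by
        have : ω ∈ Gᶜ := hωG
        simp [hχ, this]
      have hcr := crude_bookkeeping f (Z ω) y (Nv ω) Df Q ((h : ℝ) * Df (Y y)) hM₀ (hM₁ y) (hM₂ y)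
      rw [← hnN] at hcr
      refine hcr.trans ?_
      rw [hχ1, mul_one]
      have h1 : M₁ * nN ≤ lam₁ / 2 * M₁ * nN ^ 2 + M₁ / (2 * lam₁) := by
        have := mul_le_mul_of_nonneg_left (le_amgm_sq nN hlam₁0) hM₁0
        calc M₁ * nN ≤ M₁ * (lam₁ / 2 * nN ^ 2 + 1 / (2 * lam₁)) := this
          _ = lam₁ / 2 * M₁ * nN ^ 2 + M₁ / (2 * lam₁) := by ring
      have h2 : M₂ / 2 * nN ^ 2 ≤ M₂ / 4 * nN ^ 4 + M₂ / 4 := by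
        have := mul_le_mul_of_nonneg_left (sq_le_pow_four_half nN) (by positivity : 0 ≤ M₂ / 2)
        linarith
      have h3 : 0 ≤ (2 * ε' + M₂ * h * Y₁ / (2 * lam')) * nN ^ 2 := by positivity
      rw [hγ₂, hγ₄, hγc]
      have e1 : (2 * ε' + M₂ * ↑h * Y₁ / (2 * lam') + lam₁ / 2 * M₁) * nN ^ 2 =
          (2 * ε' + M₂ * ↑h * Y₁ / (2 * lam')) * nN ^ 2 + lam₁ / 2 * M₁ * nN ^ 2 := by ring
      rw [e1]
      linarith
  ---------------------------------------------------------------------------------------------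
  -- Step 2: integrate
  ---------------------------------------------------------------------------------------------
  have hZm : Measurable Z := D.measurable_sdeSolMap_pairPath_right hv₁ hv₂ h y
  have hNvm : Measurable Nv := measurable_noiseVec v₁ v₂ h
  have hfZ_int : Integrable (fun ω => f (Z ω)) wienerPair :=
    (integrable_const M₀).mono' (hf.continuous.measurable.comp hZm).aestronglyMeasurable
      (Eventually.of_forall fun ω => hM₀ _)
  have hDfN_int : Integrable (fun ω => Df (Nv ω)) wienerPair := integrable_clm_noiseVec v₁ v₂ h Df
  have hQN_int : Integrable (fun ω => Q (Nv ω) (Nv ω)) wienerPair := integrable_bilin_noiseVec v₁ v₂ h Q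
  have hW_int : Integrable W wienerPair :=
    (((hfZ_int.sub (integrable_const _)).sub hDfN_int).sub (hQN_int.const_mul _)).sub (integrable_const _)
  have hN2_int := integrable_norm_noiseVec_sq v₁ v₂ h
  have hN4_int := integrable_norm_noiseVec_pow_four v₁ v₂ h
  have hGm : MeasurableSet G := measurableSet_goodEvent a h
  have hχ_int : Integrable χ wienerPair := (integrable_const (1 : ℝ)).indicator hGm.compl
  -- `∫ W = E f(Z) - f(y) - h Lf(y)`
  have hW_integral : ∫ ω, W ω ∂wienerPair =
      (∫ ω, f (Z ω) ∂wienerPair) - f y - h * sdeGenerator Y v₁ v₂ f y := by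
    have e1 : ∫ ω, W ω ∂wienerPair = (∫ ω, f (Z ω) ∂wienerPair) - f y - (∫ ω, Df (Nv ω) ∂wienerPair) -
        (1 / 2) * (∫ ω, Q (Nv ω) (Nv ω) ∂wienerPair) - h * Df (Y y) := by
      have i1 : Integrable (fun ω => f (Z ω) - f y) wienerPair := hfZ_int.sub (integrable_const _)
      have i2 : Integrable (fun ω => f (Z ω) - f y - Df (Nv ω)) wienerPair := i1.sub hDfN_int
      have i3 : Integrable (fun ω => f (Z ω) - f y - Df (Nv ω) - (1 / 2) * Q (Nv ω) (Nv ω)) wienerPair :=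
        i2.sub (hQN_int.const_mul _)
      simp only [hW]
      rw [integral_sub i3 (integrable_const _), integral_sub i2 (hQN_int.const_mul _), integral_sub i1 hDfN_int,
        integral_sub hfZ_int (integrable_const _), integral_const, integral_const, integral_const_mul]
      simp [probReal_univ]
    rw [e1, integral_clm_noiseVec v₁ v₂ h Df, integral_bilin_noiseVec v₁ v₂ h Q, sdeGenerator]
    ring
  -- the bound integrates to `γ₀ + γ₂ E‖N‖² + γ₄ E‖N‖⁴ + γc P(Gᶜ)`
  have hbound_int : Integrable (fun ω => γ₀ + γ₂ * ‖Nv ω‖ ^ 2 + γ₄ * ‖Nv ω‖ ^ 4 + γc * χ ω) wienerPair :=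
    (((integrable_const _).add (hN2_int.const_mul _)).add (hN4_int.const_mul _)).add (hχ_int.const_mul _)
  have hχ_integral : ∫ ω, χ ω ∂wienerPair ≤ 16 * (h : ℝ) ^ 2 / a ^ 4 := by
    rw [hχ, integral_indicator_one hGm.compl]
    have hm := measure_compl_goodEvent_le ha0.le h (by have := pow_pos ha0 2; linarith)
    have h2 : (wienerPair Gᶜ).toReal ≤ 2 * (2 * (h : ℝ) ^ 2 / (a ^ 2 - h) ^ 2) := by
      have := ENNReal.toReal_mono (by simp [ENNReal.mul_eq_top]) hm
      rwa [ENNReal.toReal_mul, ENNReal.toReal_ofReal (by positivity), ENNReal.toReal_ofNat] at this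
    refine (show Measure.real wienerPair Gᶜ = (wienerPair Gᶜ).toReal from rfl).le.trans (h2.trans ?_)
    have h3 : a ^ 2 / 2 ≤ a ^ 2 - h := by linarith
    have h4 : 0 < a ^ 2 / 2 := by positivity
    calc 2 * (2 * (h : ℝ) ^ 2 / (a ^ 2 - h) ^ 2) ≤ 2 * (2 * (h : ℝ) ^ 2 / (a ^ 2 / 2) ^ 2) := by
          gcongr
      _ = 16 * (h : ℝ) ^ 2 / a ^ 4 := by field_simp; ring
  have hmain : |∫ ω, W ω ∂wienerPair| ≤ γ₀ + γ₂ * (K₂ * h) + γ₄ * (K₄ * (h : ℝ) ^ 2) + γc * (16 * (h : ℝ) ^ 2 / a ^ 4) := by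
    calc |∫ ω, W ω ∂wienerPair| ≤ ∫ ω, |W ω| ∂wienerPair := abs_integral_le_integral_abs
      _ ≤ ∫ ω, (γ₀ + γ₂ * ‖Nv ω‖ ^ 2 + γ₄ * ‖Nv ω‖ ^ 4 + γc * χ ω) ∂wienerPair :=
          integral_mono hW_int.abs hbound_int hpt
      _ = γ₀ + γ₂ * (∫ ω, ‖Nv ω‖ ^ 2 ∂wienerPair) + γ₄ * (∫ ω, ‖Nv ω‖ ^ 4 ∂wienerPair) +
            γc * (∫ ω, χ ω ∂wienerPair) := by
          have j1 : Integrable (fun ω => γ₀ + γ₂ * ‖Nv ω‖ ^ 2) wienerPair :=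
            (integrable_const _).add (hN2_int.const_mul _)
          have j2 : Integrable (fun ω => γ₀ + γ₂ * ‖Nv ω‖ ^ 2 + γ₄ * ‖Nv ω‖ ^ 4) wienerPair :=
            j1.add (hN4_int.const_mul _)
          rw [integral_add j2 (hχ_int.const_mul _), integral_add j1 (hN4_int.const_mul _),
            integral_add (integrable_const _) (hN2_int.const_mul _), integral_const, integral_const_mul,
            integral_const_mul, integral_const_mul]
          simp [probReal_univ]
          rfl
      _ ≤ γ₀ + γ₂ * (K₂ * h) + γ₄ * (K₄ * (h : ℝ) ^ 2) + γc * (16 * (h : ℝ) ^ 2 / a ^ 4) := by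
          have i2 : ∫ ω, ‖Nv ω‖ ^ 2 ∂wienerPair ≤ K₂ * h := by
            rw [hK₂]; exact integral_norm_noiseVec_sq_le v₁ v₂ h
          have i4 : ∫ ω, ‖Nv ω‖ ^ 4 ∂wienerPair ≤ K₄ * (h : ℝ) ^ 2 := by
            rw [hK₄]; exact integral_norm_noiseVec_pow_four_le v₁ v₂ h
          gcongr
  ---------------------------------------------------------------------------------------------
  -- Step 3: the budget
  ---------------------------------------------------------------------------------------------
  rw [← hW_integral]
  refine hmain.trans ?_
  have e_i : M₁ * L₁ * h * (c * a) ≤ ε / 10 * h := by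
    have h1 := mul_le_mul_of_nonneg_left hacε hh0
    have e1 : M₁ * L₁ * ↑h * (c * a) = ↑h * (M₁ * L₁ * (c * a)) := by ring
    have e2 : ε / 10 * (h : ℝ) = ↑h * (ε / 10) := by ring
    rw [e1, e2]; exact h1
  have e_ii : M₂ * h * Y₁ * lam' / 2 ≤ ε / 20 * h := by
    have key : M₂ * Y₁ * lam' ≤ ε / 10 := by
      have k1 : M₂ * Y₁ * lam' * (10 * (M₂ * Y₁ + 1)) = M₂ * Y₁ * ε := by
        rw [hlam']; field_simp
      calc M₂ * Y₁ * lam' = M₂ * Y₁ * lam' * (10 * (M₂ * Y₁ + 1)) / (10 * (M₂ * Y₁ + 1)) := by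
            field_simp
        _ = M₂ * Y₁ * ε / (10 * (M₂ * Y₁ + 1)) := by rw [k1]
        _ ≤ (M₂ * Y₁ + 1) * ε / (10 * (M₂ * Y₁ + 1)) := by gcongr; linarith
        _ = ε / 10 := by field_simp
    have h1 := mul_le_mul_of_nonneg_left key (by positivity : (0 : ℝ) ≤ h / 2)
    have e1 : M₂ * ↑h * Y₁ * lam' / 2 = ↑h / 2 * (M₂ * Y₁ * lam') := by ring
    have e2 : ε / 20 * (h : ℝ) = ↑h / 2 * (ε / 10) := by ring
    rw [e1, e2]; exact h1
  have e_iii : 2 * ε' * (K₂ * h) ≤ ε / 10 * h := by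
    have key : 2 * ε' * K₂ ≤ ε / 10 := by
      have k1 : 2 * ε' * K₂ * (10 * (2 * K₂ + 1)) = 2 * K₂ * ε := by
        rw [hε']; field_simp
      calc 2 * ε' * K₂ = 2 * ε' * K₂ * (10 * (2 * K₂ + 1)) / (10 * (2 * K₂ + 1)) := by field_simp
        _ = 2 * K₂ * ε / (10 * (2 * K₂ + 1)) := by rw [k1]
        _ ≤ (2 * K₂ + 1) * ε / (10 * (2 * K₂ + 1)) := by gcongr; linarith
        _ = ε / 10 := by field_simp
    have h1 := mul_le_mul_of_nonneg_left key hh0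
    have e1 : 2 * ε' * (K₂ * (h : ℝ)) = ↑h * (2 * ε' * K₂) := by ring
    have e2 : ε / 10 * (h : ℝ) = ↑h * (ε / 10) := by ring
    rw [e1, e2]; exact h1
  have e_iv : lam₁ / 2 * M₁ * (K₂ * h) ≤ ε / 20 * h := by
    have key : lam₁ * M₁ * K₂ ≤ ε / 10 := by
      have k1 : lam₁ * M₁ * K₂ * (10 * (M₁ * K₂ + 1)) = M₁ * K₂ * ε := by
        rw [hlam₁]; field_simp
      calc lam₁ * M₁ * K₂ = lam₁ * M₁ * K₂ * (10 * (M₁ * K₂ + 1)) / (10 * (M₁ * K₂ + 1)) := by field_simp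
        _ = M₁ * K₂ * ε / (10 * (M₁ * K₂ + 1)) := by rw [k1]
        _ ≤ (M₁ * K₂ + 1) * ε / (10 * (M₁ * K₂ + 1)) := by gcongr; linarith
        _ = ε / 10 := by field_simp
    have h1 := mul_le_mul_of_nonneg_left key (by positivity : (0 : ℝ) ≤ h / 2)
    have e1 : lam₁ / 2 * M₁ * (K₂ * (h : ℝ)) = ↑h / 2 * (lam₁ * M₁ * K₂) := by ring
    have e2 : ε / 20 * (h : ℝ) = ↑h / 2 * (ε / 10) := by ring
    rw [e1, e2]; exact h1
  have e_quad : M₁ * L₁ * h * (h * Y₁) + M₂ * h ^ 2 * Y₁ ^ 2 / 2 + 2 * ε' * h ^ 2 * Y₁ ^ 2 +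
      M₂ * h * Y₁ / (2 * lam') * (K₂ * h) + γ₄ * (K₄ * (h : ℝ) ^ 2) + γc * (16 * (h : ℝ) ^ 2 / a ^ 4) ≤
      h * (h * Dc) := by
    have hsum : M₁ * L₁ * h * (h * Y₁) + M₂ * h ^ 2 * Y₁ ^ 2 / 2 + 2 * ε' * h ^ 2 * Y₁ ^ 2 +
        M₂ * h * Y₁ / (2 * lam') * (K₂ * h) + γ₄ * (K₄ * (h : ℝ) ^ 2) + γc * (16 * (h : ℝ) ^ 2 / a ^ 4) =
        h * (h * (M₁ * L₁ * Y₁ + M₂ * Y₁ ^ 2 / 2 + 2 * ε' * Y₁ ^ 2 + M₂ * Y₁ * K₂ / (2 * lam') +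
          γ₄ * K₄ + γc * (16 / a ^ 4))) := by
      ring
    rw [hsum]
    refine mul_le_mul_of_nonneg_left (mul_le_mul_of_nonneg_left ?_ hh0) hh0
    rw [hD]
    have : γc * (16 / a ^ 4) ≤ γc₀ * (16 / a ^ 4) := mul_le_mul_of_nonneg_right hγcle (by positivity)
    linarith
  have hfinal : γ₀ + γ₂ * (K₂ * h) + γ₄ * (K₄ * (h : ℝ) ^ 2) + γc * (16 * (h : ℝ) ^ 2 / a ^ 4) ≤ ε * h := by
    have hexp : γ₀ + γ₂ * (K₂ * h) + γ₄ * (K₄ * (h : ℝ) ^ 2) + γc * (16 * (h : ℝ) ^ 2 / a ^ 4) =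
        (M₁ * L₁ * h * (c * a) + M₂ * h * Y₁ * lam' / 2 + 2 * ε' * (K₂ * h) + lam₁ / 2 * M₁ * (K₂ * h)) +
        (M₁ * L₁ * h * (h * Y₁) + M₂ * h ^ 2 * Y₁ ^ 2 / 2 + 2 * ε' * h ^ 2 * Y₁ ^ 2 +
          M₂ * h * Y₁ / (2 * lam') * (K₂ * h) + γ₄ * (K₄ * (h : ℝ) ^ 2) + γc * (16 * (h : ℝ) ^ 2 / a ^ 4)) := by
      rw [hγ₀, hγ₂]
      ring
    rw [hexp]
    have hq : h * (h * Dc) ≤ h * (ε / 2) := mul_le_mul_of_nonneg_left hhD hh0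
    have hεh : 0 ≤ ε * h := by positivity
    linarith [e_i, e_ii, e_iii, e_iv, e_quad, hq]
  exact hfinal

end RegularConfinedDrift

end Literature.MathematicalPhysics.KineticTheory
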